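import Literature.AnabelianGeometry.SemiGraphs.ArithLevelCofinality
import Literature.AnabelianGeometry.SemiGraphs.ArithTemperedGroupLevelTopology
import Literature.AnabelianGeometry.SemiGraphs.ArithTotalEstrangementOpenKernelObstruction
import HarnessLib

/-!
# [SemiAnbd] Thm 5.4 (i) p. 66, producer T54-B: the cofinality binder `hcof` AT THE OUTER MODEL
# `π₁^temp(𝒢) ⋊^out Π_A` with its tempered topology, and what the residual binder «hfaith-arith» costs

Mochizuki, *Semi-graphs of anabelioids*, Publ. RIMS **42** (2006), §5: Def 5.1 (i) p. 62 (an action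
`ρ_𝒢 : π̂₁(A) → Aut(𝒢)` — ANY homomorphism, subject to the continuity conditions (a)–(d); (c): an open
subgroup acts trivially on the underlying semi-graph), Prop 5.2 (iv) p. 64, Thm 5.4 (i) p. 66
[cite: MochizukiSemiAnbd2006, Thm 5.4 (i) p.66].

PROOF-ONLY (cell row T54-B, `HOME/plan/GAP-LEDGER.md` G-w4d053-1; seat abc-iut-w4-d085 gen 4; the
L3-lead's ruling α49 (1) «(E) `haug`/`hopen` sources as d070 names them»).  Two things:

(1) **`hcof` at the outer model** (`hcof_arithLevelTopology_of_faithful_levels`): for the outer model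
`E := π₁^temp(𝒢) ⋊^out Π_A` (`outerSemidirectProduct ρ`) carrying abc-iut-w6-d070's tempered topology
`arithLevelTopology` (ArithTemperedGroupLevelTopology.lean), every `Φ`-stable antitone family of levels
`L n ⊇ N n` (e.g. the FINITE levels `ker π_n ⊇ ker ρ_n` of abc-iut-w4-d059's «stabBranchPairAug-ASSEMBLY»)
and compact `Π_A`, the binder `hcof : ∀ U ∈ 𝓝 1, ∃ n, aug (ker (arithAct (L n))) ⊆ U` of
abc-iut-w4-d059's `map_aug_le_conj_of_levelDict′` (p433546) follows from «hfaith-arith» ALONE — the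
inputs `hopen`/`haug` of `hcof_of_faithful_levels_nat` (ArithLevelCofinality.lean) being d070's
`isOpen_ker_arithAct_of_le` / `isOpenMap_outerSemidirectProductSnd`, and `ker_arithAct_anti` below.

(2) **What «hfaith-arith» costs** (`ker_inf_ker_eq_bot_of_faithful_levels`): an element `a ∈ Π_A` acting
trivially on `π₁^temp(𝒢)` up to inner automorphisms AND trivially on the underlying semi-graph
(`a ∈ ker ρ ⊓ ker baseAct`) has the lift `(1, a) ∈ E` (abc-iut-w4-d040's `one_prod_mem_outerSemidirectProduct_of_mem_ker`,
ArithTotalEstrangementOpenKernelObstruction.lean, reused), which acts trivially on EVERY coset level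
(`arithAct_eq_one_of_map_eq_one`: `Φ e = 1 ∧ σ e = 1 ⇒ arithAct e = 1`, abc-iut-L3-d4's
`arithAct_eq_deckAct_of_inner` at `g := 1`); so `ker ρ ⊓ ker baseAct ≤ aug (ker (arithAct L))` at every
level (`ker_inf_ker_le_map_ker_arithAct`), and «hfaith-arith» (`∀ a, (∀ n, a ∈ aug (ker (arithAct (L n))))
→ a = 1`) FORCES `ker ρ ⊓ ker baseAct = ⊥`: the joint action `(ρ, baseAct)` of `Π_A` on `𝒢` must be
FAITHFUL.  Print's Def 5.1 (i) does not ask this (nor does the frame of Thm 5.4), so a T54-B capstone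
carrying «hfaith-arith» (equivalently `hcof`, ArithLevelCofinality.lean) types a NARROWER hypothesis than
print's Thm 5.4 (i) — recorded, not repaired, here (GAP-LEDGER: the weakest binder the (AI4″) route needs
is `⨅ n, aug (ker (arithAct (L n))) ≤ ker ρ ⊓ ker baseAct`).

No definition, no new named fact, no instance; nothing here refers to the IUT corpus beyond the producer
row it serves; no side is taken on [IUTchIII] Cor 3.12; typed ≠ proved for the residual binders.
-/

namespace Literature.AnabelianGeometry.SemiGraphs

/-! ### Generic: kernels of the arithmetic actions along a subgroup presentation -/

namespace SemiGraph

namespace SubgroupPresentation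

open CategoryTheory

universe u v

variable {𝔾 : SemiGraph.{u}} {Γ : Type u} [Group Γ] {E : Type v} [Group E]
  (P : SubgroupPresentation 𝔾 Γ) {Φ : E →* MulAut Γ} {σ : E →* Aut 𝔾} (hP : P.IsArithCompatible Φ σ)

/-- **Kernel antitonicity of the arithmetic actions**: acting trivially on the finer coset level `K`
implies acting trivially on the coarser level `K' ⊇ K` (the transition maps are equivariant,
`arithAct_trans`, and surjective on representatives). [cite: MochizukiSemiAnbd2006, Thm 5.4 (i) p.66] -/
theorem ker_arithAct_anti {K K' : Subgroup Γ} (hK : ∀ (e : E) (x : Γ), x ∈ K → Φ e x ∈ K)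
    (hK' : ∀ (e : E) (x : Γ), x ∈ K' → Φ e x ∈ K') (h : K ≤ K') :
    (P.arithAct hP K hK).ker ≤ (P.arithAct hP K' hK').ker := by
  intro e he
  rw [MonoidHom.mem_ker] at he ⊢
  ext : 1
  have htr := P.arithAct_trans hP hK hK' h e
  rw [he] at htr
  refine P.hom_ext_mk K' _ _ (fun w y => ?_) (fun ε y => ?_) (fun b y => ?_)
  · exact (congrArg (fun f : P.cosetGraph K ⟶ P.cosetGraph K' => f.vertexMap (P.vMk K w y)) htr).symm
  · exact (congrArg (fun f : P.cosetGraph K ⟶ P.cosetGraph K' => f.edgeMap (P.eMk K ε y)) htr).symm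
  · exact (congrArg (fun f : P.cosetGraph K ⟶ P.cosetGraph K' => f.branchMap (P.bMk K b y)) htr).symm

/-- **Elements acting trivially on `Γ` and on `𝔾` act trivially on every coset level**: `Φ e = 1` and
`σ e = 1` imply `arithAct e = 1` (abc-iut-L3-d4's `arithAct_eq_deckAct_of_inner` at `g := 1`).
[cite: MochizukiSemiAnbd2006, Thm 5.4 (i) p.66] -/
theorem arithAct_eq_one_of_map_eq_one (K : Subgroup Γ) [K.Normal]
    (hK : ∀ (e : E) (x : Γ), x ∈ K → Φ e x ∈ K) {e : E} (hΦ : Φ e = 1) (hσ : σ e = 1) :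
    P.arithAct hP K hK e = 1 :=
  P.arithAct_eq_one_of_inner_mem hP K hK (g := 1) (by rw [hΦ, map_one]) hσ K.one_mem

/-- The same, as membership in the kernel of the level action. [cite: MochizukiSemiAnbd2006, Thm 5.4 (i) p.66] -/
theorem mem_ker_arithAct_of_map_eq_one (K : Subgroup Γ) [K.Normal]
    (hK : ∀ (e : E) (x : Γ), x ∈ K → Φ e x ∈ K) {e : E} (hΦ : Φ e = 1) (hσ : σ e = 1) :
    e ∈ (P.arithAct hP K hK).ker :=
  (MonoidHom.mem_ker).mpr (P.arithAct_eq_one_of_map_eq_one hP K hK hΦ hσ)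

end SubgroupPresentation

end SemiGraph

/-! ### At the outer model `E := π₁^temp(𝒢) ⋊^out Π_A` -/

namespace ProfiniteSemiGraph

open CategoryTheory Topology Filter
open Literature.AnabelianGeometry.EtaleTheta

universe u

variable {𝒢 : ProfiniteSemiGraph.{u}} (c : TemperedPiChart 𝒢)
  {PA : Type u} [Group PA] [TopologicalSpace PA] [IsTopologicalGroup PA]
  (ρ : PA →* TopOut c.G) (baseAct : PA →* Aut 𝒢.graph)

section Obstruction

variable (P : SemiGraph.SubgroupPresentation 𝒢.graph c.G)
  (hP : P.IsArithCompatible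
    (((contMulAut c.G).subtype.comp (MonoidHom.fst (contMulAut c.G) PA)).comp
      (outerSemidirectProduct ρ).subtype)
    (baseAct.comp (outerSemidirectProductSnd ρ)))

omit [TopologicalSpace PA] [IsTopologicalGroup PA] in
/-- **`ker ρ ⊓ ker baseAct` lies in the `Π_A`-image of the kernel of EVERY level action**: an element of
`Π_A` acting trivially on `π₁^temp(𝒢)` up to inner automorphisms and trivially on the underlying semi-graph
has the lift `(1, a)`, which acts trivially on every coset level. [cite: MochizukiSemiAnbd2006, Thm 5.4 (i) p.66] -/
theorem ker_inf_ker_le_map_ker_arithAct (L : Subgroup c.G) [L.Normal]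
    (hL : ∀ (e : outerSemidirectProduct ρ) (x : c.G), x ∈ L →
      (((contMulAut c.G).subtype.comp (MonoidHom.fst (contMulAut c.G) PA)).comp
        (outerSemidirectProduct ρ).subtype) e x ∈ L) :
    ρ.ker ⊓ baseAct.ker ≤
      ((P.arithAct hP L hL).ker).map (outerSemidirectProductSnd ρ) := by
  intro a ha
  obtain ⟨hρ, hσ⟩ := Subgroup.mem_inf.mp ha
  let e : outerSemidirectProduct ρ := ⟨((1 : contMulAut c.G), a), one_prod_mem_outerSemidirectProduct_of_mem_ker c ρ hρ⟩
  have haug : outerSemidirectProductSnd ρ e = a := rfl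
  refine ⟨e, ?_, haug⟩
  refine P.mem_ker_arithAct_of_map_eq_one hP L hL (e := e) ?_ ?_
  · rfl
  · rw [MonoidHom.comp_apply, haug]
    exact (MonoidHom.mem_ker).mp hσ

omit [TopologicalSpace PA] [IsTopologicalGroup PA] in
/-- **What the binder «hfaith-arith» costs**: if no `a ≠ 1` of `Π_A` lies in the image of the kernel of
every level action (the hypothesis `hfaith` of `hcof_of_faithful_levels`, ArithLevelCofinality.lean —
equivalent to the cofinality binder `hcof` under the capstone's side conditions), then
`ker ρ ⊓ ker baseAct = ⊥`: the joint action of `Π_A` on `𝒢` is FAITHFUL.  [SemiAnbd] Def 5.1 (i) p. 62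
imposes no such faithfulness on `ρ_𝒢`; this lemma records that a T54-B capstone carrying «hfaith-arith»
types a narrower hypothesis than print's Thm 5.4 (i). [cite: MochizukiSemiAnbd2006, Thm 5.4 (i) p.66] -/
theorem ker_inf_ker_eq_bot_of_faithful_levels {J : Type*} [Nonempty J] (L : J → Subgroup c.G)
    [∀ j, (L j).Normal]
    (hL : ∀ (j : J) (e : outerSemidirectProduct ρ) (x : c.G), x ∈ L j →
      (((contMulAut c.G).subtype.comp (MonoidHom.fst (contMulAut c.G) PA)).comp
        (outerSemidirectProduct ρ).subtype) e x ∈ L j)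
    (hfaith : ∀ a : PA,
      (∀ j, a ∈ ((P.arithAct hP (L j) (hL j)).ker).map (outerSemidirectProductSnd ρ)) → a = 1) :
    ρ.ker ⊓ baseAct.ker = ⊥ := by
  refine (Subgroup.eq_bot_iff_forall _).mpr fun a ha => hfaith a fun j => ?_
  exact ker_inf_ker_le_map_ker_arithAct c ρ baseAct P hP (L j) (hL j) ha

omit [TopologicalSpace PA] [IsTopologicalGroup PA] in
/-- Contrapositive reading: a NON-faithful joint action (`ker ρ ⊓ ker baseAct ≠ ⊥`) refutes «hfaith-arith»
at every family of levels. [cite: MochizukiSemiAnbd2006, Thm 5.4 (i) p.66] -/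
theorem not_faithful_levels_of_ker_inf_ker_ne_bot {J : Type*} [Nonempty J] (L : J → Subgroup c.G)
    [∀ j, (L j).Normal]
    (hL : ∀ (j : J) (e : outerSemidirectProduct ρ) (x : c.G), x ∈ L j →
      (((contMulAut c.G).subtype.comp (MonoidHom.fst (contMulAut c.G) PA)).comp
        (outerSemidirectProduct ρ).subtype) e x ∈ L j)
    (hne : ρ.ker ⊓ baseAct.ker ≠ ⊥) :
    ¬ ∀ a : PA,
      (∀ j, a ∈ ((P.arithAct hP (L j) (hL j)).ker).map (outerSemidirectProductSnd ρ)) → a = 1 :=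
  fun hfaith => hne (ker_inf_ker_eq_bot_of_faithful_levels c ρ baseAct P hP L hL hfaith)

omit [IsTopologicalGroup PA] in
/-- **Conversely**, at the outer model `hcof` implies «hfaith-arith» (`Π_A` is Hausdorff for
`arithLevelTopology`-compatible data whenever it is a T₁ topological group): the two binders are
EQUIVALENT there, so (2) above prices `hcof` as well. [cite: MochizukiSemiAnbd2006, Thm 5.4 (i) p.66] -/
theorem faithful_levels_of_hcof_outerAction [T1Space PA] (L : ℕ → Subgroup c.G)
    (hLst : ∀ (n : ℕ) (e : outerSemidirectProduct ρ) (x : c.G), x ∈ L n →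
      (((contMulAut c.G).subtype.comp (MonoidHom.fst (contMulAut c.G) PA)).comp
        (outerSemidirectProduct ρ).subtype) e x ∈ L n)
    (hcof : ∀ U ∈ 𝓝 (1 : PA), ∃ n, ∀ e ∈ (P.arithAct hP (L n) (hLst n)).ker,
      outerSemidirectProductSnd ρ e ∈ U) :
    ∀ a : PA,
      (∀ n, a ∈ ((P.arithAct hP (L n) (hLst n)).ker).map (outerSemidirectProductSnd ρ)) → a = 1 :=
  forall_mem_map_imp_eq_one_of_cofinal_map (outerSemidirectProductSnd ρ)
    (fun n => (P.arithAct hP (L n) (hLst n)).ker) hcof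

omit [IsTopologicalGroup PA] in
/-- **Hence `hcof` at the outer model also forces faithfulness of the joint action.**
[cite: MochizukiSemiAnbd2006, Thm 5.4 (i) p.66] -/
theorem ker_inf_ker_eq_bot_of_hcof_outerAction [T1Space PA] (L : ℕ → Subgroup c.G) [∀ n, (L n).Normal]
    (hLst : ∀ (n : ℕ) (e : outerSemidirectProduct ρ) (x : c.G), x ∈ L n →
      (((contMulAut c.G).subtype.comp (MonoidHom.fst (contMulAut c.G) PA)).comp
        (outerSemidirectProduct ρ).subtype) e x ∈ L n)
    (hcof : ∀ U ∈ 𝓝 (1 : PA), ∃ n, ∀ e ∈ (P.arithAct hP (L n) (hLst n)).ker,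
      outerSemidirectProductSnd ρ e ∈ U) :
    ρ.ker ⊓ baseAct.ker = ⊥ :=
  ker_inf_ker_eq_bot_of_faithful_levels c ρ baseAct P hP L hLst
    (faithful_levels_of_hcof_outerAction c ρ baseAct P hP L hLst hcof)

end Obstruction

/-! ### (E) instantiated: `hcof` for `arithLevelTopology` from «hfaith-arith» -/

section Cofinality

variable [FirstCountableTopology c.G]
  (h36 : 𝒢.Prop36Hypotheses) (hA : IsTempered PA)
  (P : SemiGraph.SubgroupPresentation 𝒢.graph c.G)
  (hP : P.IsArithCompatible
    (((contMulAut c.G).subtype.comp (MonoidHom.fst (contMulAut c.G) PA)).comp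
      (outerSemidirectProduct ρ).subtype)
    (baseAct.comp (outerSemidirectProductSnd ρ)))
  (w₀ : 𝒢.graph.Vertex) (hcpt : IsCompact (P.H w₀ : Set c.G))
  (N : ℕ → Subgroup c.G) (hNn : ∀ n, (N n).Normal)
  (hNst : ∀ (n : ℕ) (e : outerSemidirectProduct ρ) (x : c.G), x ∈ N n →
    (((contMulAut c.G).subtype.comp (MonoidHom.fst (contMulAut c.G) PA)).comp
      (outerSemidirectProduct ρ).subtype) e x ∈ N n)
  (hNanti : Antitone N) (hNopen : ∀ n, IsOpen (N n : Set c.G))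
  (hNcof : ∀ U ∈ 𝓝 (1 : c.G), ∃ n, (N n : Set c.G) ⊆ U)
  (hK1' : ∀ n, IsOpen (((P.levelKer hP (N n) (hNst n)).map (outerSemidirectProductSnd ρ) :
    Subgroup PA) : Set PA))

include h36 hA hcpt hNn hNanti hNopen hNcof hK1'

/-- **(E) at the outer model: `hcof` for the tempered topology `arithLevelTopology` from «hfaith-arith»**
([SemiAnbd] Thm 5.4 (i) p. 66; the `hcof` binder of abc-iut-w4-d059's `map_aug_le_conj_of_levelDict′`,
p433546, at `E := π₁^temp(𝒢) ⋊^out Π_A`): for compact `Π_A` and any `Φ`-stable ANTITONE family of levels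
`L n ⊇ N n` (e.g. the finite levels `ker π_n ⊇ ker ρ_n`), if no `a ≠ 1` of `Π_A` has at every level a
lift acting trivially on that level's coset semi-graph, then the images in `Π_A` of the level kernels
shrink to `1`.  Inputs BY NAME: abc-iut-w6-d070's `isOpen_ker_arithAct_of_le` (`hopen`),
`isOpenMap_outerSemidirectProductSnd` (`haug`), and `hcof_of_faithful_levels_nat` (ArithLevelCofinality).
[cite: MochizukiSemiAnbd2006, Thm 5.4 (i) p.66] -/
theorem hcof_arithLevelTopology_of_faithful_levels [CompactSpace PA]
    (L : ℕ → Subgroup c.G)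
    (hLst : ∀ (n : ℕ) (e : outerSemidirectProduct ρ) (x : c.G), x ∈ L n →
      (((contMulAut c.G).subtype.comp (MonoidHom.fst (contMulAut c.G) PA)).comp
        (outerSemidirectProduct ρ).subtype) e x ∈ L n)
    (hNL : ∀ n, N n ≤ L n) (hLanti : Antitone L)
    (hfaith : ∀ a : PA,
      (∀ n, a ∈ ((P.arithAct hP (L n) (hLst n)).ker).map (outerSemidirectProductSnd ρ)) → a = 1) :
    ∀ U ∈ 𝓝 (1 : PA), ∃ n, ∀ e ∈ (P.arithAct hP (L n) (hLst n)).ker,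
      outerSemidirectProductSnd ρ e ∈ U := by
  letI := arithLevelTopology c ρ baseAct h36 hA P hP w₀ hcpt N hNn hNst hNanti hNopen hNcof hK1'
  exact hcof_of_faithful_levels_nat (outerSemidirectProductSnd ρ) (fun n => P.cosetGraph (L n))
    (fun n => P.arithAct hP (L n) (hLst n))
    (fun i j hij => P.ker_arithAct_anti hP (hLst j) (hLst i) (hLanti hij))
    (fun n => isOpen_ker_arithAct_of_le c ρ baseAct h36 hA P hP w₀ hcpt N hNn hNst hNanti hNopen hNcof
      hK1' (hLst n) (hNL n))
    (isOpenMap_outerSemidirectProductSnd c ρ baseAct h36 hA P hP w₀ hcpt N hNn hNst hNanti hNopen hNcof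
      hK1')
    hfaith

/-- **(E) at the outer model, for the level kernels `N n` themselves.** [cite: MochizukiSemiAnbd2006, Thm 5.4 (i) p.66] -/
theorem hcof_arithLevelTopology_of_faithful_levels_self [CompactSpace PA]
    (hfaith : ∀ a : PA,
      (∀ n, a ∈ ((P.arithAct hP (N n) (hNst n)).ker).map (outerSemidirectProductSnd ρ)) → a = 1) :
    ∀ U ∈ 𝓝 (1 : PA), ∃ n, ∀ e ∈ (P.arithAct hP (N n) (hNst n)).ker,
      outerSemidirectProductSnd ρ e ∈ U :=
  hcof_arithLevelTopology_of_faithful_levels c ρ baseAct h36 hA P hP w₀ hcpt N hNn hNst hNanti hNopen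
    hNcof hK1' N hNst (fun _ => le_rfl) hNanti hfaith

end Cofinality

/-! ### v2 (append-only): the two instantiation-side terms of the hcof-FREE producer
`map_aug_le_conj_of_levelDict_modKernel` (ArithBranchPairAugModKernel.lean): `hUclosed` and `hU` at the
outer model, the latter from the weaker residual «hU-arith : U_∞ ≤ ker ρ ⊓ ker baseAct» -/

section ModKernelInputs

variable (P : SemiGraph.SubgroupPresentation 𝒢.graph c.G)
  (hP : P.IsArithCompatible
    (((contMulAut c.G).subtype.comp (MonoidHom.fst (contMulAut c.G) PA)).comp
      (outerSemidirectProduct ρ).subtype)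
    (baseAct.comp (outerSemidirectProductSnd ρ)))

omit [TopologicalSpace PA] [IsTopologicalGroup PA] in
/-- **`hU` of `map_aug_le_conj_of_levelDict_modKernel` at the outer model, from «hU-arith»**: if every
element of `U_∞ := ⋂ⱼ aug (ker (arithAct (L j)))` acts trivially on `𝒢` (`hUar : U_∞ ≤ ker ρ ⊓ ker baseAct`
— the weaker, print-compatible residual replacing «hfaith-arith»), then it is realised by the lift
`(1, a) ∈ Π^temp_{𝔊,v₀} = arithVertGp Rc ι v₀` (abc-iut-w4-d040's `one_prod_mem_arithVertGp_of_mem_ker`),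
which acts trivially at EVERY level (`arithAct_eq_one_of_map_eq_one`).
[cite: MochizukiSemiAnbd2006, Thm 5.4 (i) p.66] -/
theorem hU_arithVertGp_of_iInf_map_ker_le {J : Type*} (L : J → Subgroup c.G) [∀ j, (L j).Normal]
    (hL : ∀ (j : J) (e : outerSemidirectProduct ρ) (x : c.G), x ∈ L j →
      (((contMulAut c.G).subtype.comp (MonoidHom.fst (contMulAut c.G) PA)).comp
        (outerSemidirectProduct ρ).subtype) e x ∈ L j)
    (Rc : ChartRepresentatives c) (v₀ : 𝒢.graph.Vertex)
    (hUar : ∀ a : PA,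
      (∀ j, a ∈ ((P.arithAct hP (L j) (hL j)).ker).map (outerSemidirectProductSnd ρ)) →
        a ∈ ρ.ker ⊓ baseAct.ker)
    {M : Type*} (K : M → Subgroup c.G) [∀ m, (K m).Normal]
    (hK : ∀ (m : M) (e : outerSemidirectProduct ρ) (x : c.G), x ∈ K m →
      (((contMulAut c.G).subtype.comp (MonoidHom.fst (contMulAut c.G) PA)).comp
        (outerSemidirectProduct ρ).subtype) e x ∈ K m) :
    ∀ a : PA, (∀ j, a ∈ ((P.arithAct hP (L j) (hL j)).ker).map (outerSemidirectProductSnd ρ)) →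
      ∃ z ∈ arithVertGp Rc (toOuterSemidirectProduct ρ) v₀,
        outerSemidirectProductSnd ρ z = a ∧ ∀ m, P.arithAct hP (K m) (hK m) z = 1 := by
  intro a ha
  obtain ⟨hρ, hσ⟩ := Subgroup.mem_inf.mp (hUar a ha)
  refine ⟨⟨((1 : contMulAut c.G), a), one_prod_mem_outerSemidirectProduct_of_mem_ker c ρ hρ⟩,
    one_prod_mem_arithVertGp_of_mem_ker c ρ Rc hρ v₀, rfl, fun m => ?_⟩
  refine P.arithAct_eq_one_of_map_eq_one hP (K m) (hK m) ?_ ?_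
  · change ((1 : contMulAut c.G) : MulAut c.G) = 1
    rfl
  · rw [MonoidHom.comp_apply]
    exact (MonoidHom.mem_ker).mp hσ

omit [TopologicalSpace PA] [IsTopologicalGroup PA] in
/-- **Conversely «hfaith-arith» gives «hU-arith» trivially** (`U_∞ = ⊥ ≤ ker ρ ⊓ ker baseAct`): the new
residual is WEAKER than the old one. [cite: MochizukiSemiAnbd2006, Thm 5.4 (i) p.66] -/
theorem iInf_map_ker_le_of_faithful_levels {J : Type*} (L : J → Subgroup c.G)
    (hL : ∀ (j : J) (e : outerSemidirectProduct ρ) (x : c.G), x ∈ L j →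
      (((contMulAut c.G).subtype.comp (MonoidHom.fst (contMulAut c.G) PA)).comp
        (outerSemidirectProduct ρ).subtype) e x ∈ L j)
    (hfaith : ∀ a : PA,
      (∀ j, a ∈ ((P.arithAct hP (L j) (hL j)).ker).map (outerSemidirectProductSnd ρ)) → a = 1) :
    ∀ a : PA, (∀ j, a ∈ ((P.arithAct hP (L j) (hL j)).ker).map (outerSemidirectProductSnd ρ)) →
      a ∈ ρ.ker ⊓ baseAct.ker := by
  intro a ha
  rw [hfaith a ha]
  exact (ρ.ker ⊓ baseAct.ker).one_mem

omit [TopologicalSpace PA] [IsTopologicalGroup PA] in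
/-- **At a TRIVIAL joint action «hU-arith» holds outright** (`ker ρ ⊓ ker baseAct = ⊤`): e.g. at the
split non-vacuity designs `ρ = 1`, `baseAct = 1` of the T54 binder board (abc-iut-w6-d099 / w5-d236
witnesses) the new residual is discharged — whereas «hfaith-arith» FAILS there as soon as `Π_A ≠ 1`
(`not_faithful_levels_of_trivial` below). [cite: MochizukiSemiAnbd2006, Thm 5.4 (i) p.66] -/
theorem iInf_map_ker_le_of_trivial {J : Type*} (L : J → Subgroup c.G)
    (hL : ∀ (j : J) (e : outerSemidirectProduct ρ) (x : c.G), x ∈ L j →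
      (((contMulAut c.G).subtype.comp (MonoidHom.fst (contMulAut c.G) PA)).comp
        (outerSemidirectProduct ρ).subtype) e x ∈ L j)
    (hρ : ρ = 1) (hσ : baseAct = 1) :
    ∀ a : PA, (∀ j, a ∈ ((P.arithAct hP (L j) (hL j)).ker).map (outerSemidirectProductSnd ρ)) →
      a ∈ ρ.ker ⊓ baseAct.ker := by
  intro a _
  refine Subgroup.mem_inf.mpr ⟨?_, ?_⟩
  · rw [MonoidHom.mem_ker, hρ, MonoidHom.one_apply]
  · rw [MonoidHom.mem_ker, hσ, MonoidHom.one_apply]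

omit [TopologicalSpace PA] [IsTopologicalGroup PA] in
/-- **… while «hfaith-arith» fails at every trivial joint action with `Π_A ≠ 1`** (any family of levels):
the old residual EXCLUDES the split non-vacuity designs, the new one does not.
[cite: MochizukiSemiAnbd2006, Thm 5.4 (i) p.66] -/
theorem not_faithful_levels_of_trivial {J : Type*} [Nonempty J] (L : J → Subgroup c.G)
    [∀ j, (L j).Normal]
    (hL : ∀ (j : J) (e : outerSemidirectProduct ρ) (x : c.G), x ∈ L j →
      (((contMulAut c.G).subtype.comp (MonoidHom.fst (contMulAut c.G) PA)).comp
        (outerSemidirectProduct ρ).subtype) e x ∈ L j)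
    (hρ : ρ = 1) (hσ : baseAct = 1) [Nontrivial PA] :
    ¬ ∀ a : PA,
      (∀ j, a ∈ ((P.arithAct hP (L j) (hL j)).ker).map (outerSemidirectProductSnd ρ)) → a = 1 := by
  refine not_faithful_levels_of_ker_inf_ker_ne_bot c ρ baseAct P hP L hL ?_
  have htop : ρ.ker ⊓ baseAct.ker = ⊤ := by
    rw [eq_top_iff]
    intro a _
    refine Subgroup.mem_inf.mpr ⟨?_, ?_⟩
    · rw [MonoidHom.mem_ker, hρ, MonoidHom.one_apply]
    · rw [MonoidHom.mem_ker, hσ, MonoidHom.one_apply]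
  rw [htop]
  exact top_ne_bot

variable [FirstCountableTopology c.G]
  (h36 : 𝒢.Prop36Hypotheses) (hA : IsTempered PA)
  (w₀ : 𝒢.graph.Vertex) (hcpt : IsCompact (P.H w₀ : Set c.G))
  (N : ℕ → Subgroup c.G) (hNn : ∀ n, (N n).Normal)
  (hNst : ∀ (n : ℕ) (e : outerSemidirectProduct ρ) (x : c.G), x ∈ N n →
    (((contMulAut c.G).subtype.comp (MonoidHom.fst (contMulAut c.G) PA)).comp
      (outerSemidirectProduct ρ).subtype) e x ∈ N n)
  (hNanti : Antitone N) (hNopen : ∀ n, IsOpen (N n : Set c.G))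
  (hNcof : ∀ U ∈ 𝓝 (1 : c.G), ∃ n, (N n : Set c.G) ⊆ U)
  (hK1' : ∀ n, IsOpen (((P.levelKer hP (N n) (hNst n)).map (outerSemidirectProductSnd ρ) :
    Subgroup PA) : Set PA))

include h36 hA hcpt hNn hNanti hNopen hNcof hK1'

/-- **`hUclosed` of `map_aug_le_conj_of_levelDict_modKernel` at the outer model**: for the tempered topology
`arithLevelTopology` the image in `Π_A` of the kernel of the action on ANY `Φ`-stable level `L ⊇ N n` is an
OPEN subgroup (abc-iut-w6-d070: `isOpen_ker_arithAct_of_le`, `isOpenMap_outerSemidirectProductSnd`), hence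
CLOSED. [cite: MochizukiSemiAnbd2006, Thm 5.4 (i) p.66] -/
theorem isClosed_map_ker_arithAct_arithLevelTopology {L : Subgroup c.G}
    (hL : ∀ (e : outerSemidirectProduct ρ) (x : c.G), x ∈ L →
      (((contMulAut c.G).subtype.comp (MonoidHom.fst (contMulAut c.G) PA)).comp
        (outerSemidirectProduct ρ).subtype) e x ∈ L)
    {n : ℕ} (hNL : N n ≤ L) :
    IsClosed ((((P.arithAct hP L hL).ker).map (outerSemidirectProductSnd ρ) : Subgroup PA) : Set PA) := by
  letI := arithLevelTopology c ρ baseAct h36 hA P hP w₀ hcpt N hNn hNst hNanti hNopen hNcof hK1'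
  exact isClosed_map_of_isOpen (outerSemidirectProductSnd ρ)
    (isOpenMap_outerSemidirectProductSnd c ρ baseAct h36 hA P hP w₀ hcpt N hNn hNst hNanti hNopen hNcof
      hK1')
    (isOpen_ker_arithAct_of_le c ρ baseAct h36 hA P hP w₀ hcpt N hNn hNst hNanti hNopen hNcof hK1' hL hNL)

end ModKernelInputs

end ProfiniteSemiGraph

end Literature.AnabelianGeometry.SemiGraphs
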